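import Literature.Topology.FourManifolds.SpikeModel
import HarnessLib

/-!
# The spiked loop: local structure

Topic `Literature/Topology/FourManifolds` (trunk T-4MAN). Fact seat
`provefact-Literature.Topology.FourManifolds.Knot.IsConnectedSum.isIsotopic` (Schubert's theorem),
stage S1 of the proof of the geometric heart for rail knots. The spiked pieces of
`SpikeModel.lean` are inserted into the necked rail loop of `RailNeck.lean` (neck half-width
`w = κ`): on the two neck cores the necked loop is `t ↦ band (χ t, 1/2 ∓ κ)`, i.e. in the chart
`ψ⁻¹ (railLoPsi κ (α t))` with the **blown-up parameter** `α t = (χ t - 1/2)/κ`, and the **spiked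
piece function** replaces it there by `ψ⁻¹ (pieceLo κ σ u (α t))` (resp. `Hi`), through a globally
smooth formula with a window cut-off. This file sets up the modification and proves its local
properties: it agrees with the necked piece function off the **spike set** and at `u = 0`, is
jointly `C^∞`, unit, regular and injective on the spike set in the flat regime; the global
disjointness from the rest of the loop and the resulting isotopy are in the sequel.

* `windowCut` (`1` on `[0, 5]`, `0` off `(-1, 6)`); `b.chiLo`, `b.chiHi`, `b.alphaLo κ`, `b.alphaHi κ`
  (the blown-up parameters), `b.gapLo`, `b.gapHi` (the core gaps, positive) and the localisation
  lemmas `mem_coreLo_of_alphaLo` (`|α t| < M`, `κ M ≤ gapLo` puts `t` in the open core);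
* `b.spikePiece hcross κ σ u`, `b.spikeSet κ`; `spikePiece_coreLo` (on the core it is the new point
  `ψ⁻¹ (pieceLo …)`), `spikePiece_eq_neckPiece` (off the spike set), `spikePiece_zero` (`u = 0`),
  `norm_spikePiece`, `contDiff_spikePiece` (jointly `C^∞`), `deriv_spikePiece_ne_zero`,
  `injOn_spikePiece` (in the flat regime `b.IsFlat hcross ε r` with `8κ < r`,
  `ε (1 + 8B) ≤ 1/2`, `8ε ≤ 5/6`);
* `fderiv_coe_psiN_symm_injective`: the chart inverse followed by the inclusion is an immersion.

Everything is proved; no named facts are introduced.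

## References

* M. W. Hirsch, *Differential Topology*, GTM 33, Springer (1976), Ch. 8 §1, Thm. 1.3 (isotopy
  extension). [HirschDT1976]
-/

open scoped Manifold ContDiff Topology Real
open Function Set Metric Filter

noncomputable section

namespace Literature.Topology.FourManifolds

/-- Local notation: `𝔼 n` is the model Euclidean space `EuclideanSpace ℝ (Fin n)`. -/
local notation "𝔼 " n:arg => EuclideanSpace ℝ (Fin n)

/-- Local notation: `𝕊 n` is the unit sphere in `EuclideanSpace ℝ (Fin (n + 1))`. -/
local notation "𝕊 " n:arg => (Metric.sphere (0 : EuclideanSpace ℝ (Fin (n + 1))) 1)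

attribute [local instance] fact_finrank_euclideanSpace_succ

open KnotsInBall

/-! ### The window cut-off -/

/-- **The window cut-off**: `1` on `[0, 5]`, `0` off `(-1, 6)`. [folklore] -/
def windowCut (α : ℝ) : ℝ := smoothStep (-1) 0 α * (1 - smoothStep 5 6 α)

/-- The window cut-off is `C^∞`. [folklore] -/
theorem contDiff_windowCut : ContDiff ℝ ∞ windowCut :=
  (contDiff_smoothStep _ _).mul (contDiff_const.sub (contDiff_smoothStep _ _))

/-- The window cut-off is `1` on `[0, 5]`. [folklore] -/
theorem windowCut_eq_one {α : ℝ} (h : α ∈ Icc (0 : ℝ) 5) : windowCut α = 1 := by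
  rw [windowCut, smoothStep_of_ge (by norm_num) h.1, smoothStep_of_le (by norm_num) h.2]; ring

/-- The window cut-off vanishes off `(-1, 6)`. [folklore] -/
theorem windowCut_eq_zero {α : ℝ} (h : α ∉ Ioo (-1 : ℝ) 6) : windowCut α = 0 := by
  rcases le_or_gt α (-1) with h1 | h1
  · rw [windowCut, smoothStep_of_le (by norm_num) h1]; ring
  · rw [windowCut, smoothStep_of_ge (by norm_num) (not_lt.1 fun h2 ↦ h ⟨h1, h2⟩)]; ring

/-- Where the window cut-off is not `1`, the spike bump vanishes (`[0, 5]ᶜ ⊆ (1/8, 4)ᶜ`).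
[folklore] -/
theorem spikeBump_eq_zero_of_windowCut_ne_one {α : ℝ} (h : windowCut α ≠ 1) : spikeBump α = 0 := by
  apply spikeBump_eq_zero_of_not_mem
  intro hα
  exact h (windowCut_eq_one ⟨by linarith [hα.1], by linarith [hα.2]⟩)

namespace BandData

variable {A B K : Knot} {avoid : Set (𝕊 3)} (b : BandData A B K avoid)
  (hcross : b.band ⁻¹' sphereEquator 2 ∩ squareNhd b.δ = {x ∈ squareNhd b.δ | x 0 = 2⁻¹})

/-! ### The blown-up parameters on the two cores -/

/-- The first coordinate of the lower rail on its plateau: `χ₁ = smoothStep (alo + ε) (tlo - ε)`.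
[folklore] -/
def chiLo (t : ℝ) : ℝ := smoothStep (b.alo + b.epsLo) (b.tlo - b.epsLo) t

/-- The first coordinate of the upper rail on its plateau: `χ₂ (-t)`,
`χ₂ = smoothStep (-ahi + ε') (-thi - ε')`. [folklore] -/
def chiHi (t : ℝ) : ℝ := smoothStep (-b.ahi + b.epsHi) (-b.thi - b.epsHi) (-t)

/-- **The lower blown-up parameter** `α t = (χ₁ t - 1/2)/κ`. [folklore] -/
def alphaLo (κ t : ℝ) : ℝ := (b.chiLo t - 1 / 2) / κ

/-- **The upper blown-up parameter** `α t = (χ₂ (-t) - 1/2)/κ`. [folklore] -/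
def alphaHi (κ t : ℝ) : ℝ := (b.chiHi t - 1 / 2) / κ

/-- `χ₁` is `C^∞`. [folklore] -/
theorem contDiff_chiLo : ContDiff ℝ ∞ b.chiLo := contDiff_smoothStep _ _

/-- `χ₂ (-·)` is `C^∞`. [folklore] -/
theorem contDiff_chiHi : ContDiff ℝ ∞ b.chiHi := (contDiff_smoothStep _ _).comp contDiff_neg

/-- The lower blown-up parameter is `C^∞` in `t`. [folklore] -/
theorem contDiff_alphaLo (κ : ℝ) : ContDiff ℝ ∞ (b.alphaLo κ) :=
  (b.contDiff_chiLo.sub contDiff_const).div_const _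

/-- The upper blown-up parameter is `C^∞` in `t`. [folklore] -/
theorem contDiff_alphaHi (κ : ℝ) : ContDiff ℝ ∞ (b.alphaHi κ) :=
  (b.contDiff_chiHi.sub contDiff_const).div_const _

/-- `κ α t = χ₁ t - 1/2`. [folklore] -/
theorem mul_alphaLo {κ : ℝ} (hκ : κ ≠ 0) (t : ℝ) : κ * b.alphaLo κ t = b.chiLo t - 1 / 2 := by
  rw [alphaLo]; field_simp

/-- `κ α t = χ₂ (-t) - 1/2`. [folklore] -/
theorem mul_alphaHi {κ : ℝ} (hκ : κ ≠ 0) (t : ℝ) : κ * b.alphaHi κ t = b.chiHi t - 1 / 2 := by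
  rw [alphaHi]; field_simp

/-- `χ₁` is monotone. [folklore] -/
theorem monotone_chiLo : Monotone b.chiLo :=
  monotone_smoothStep (by linarith [b.cLo_hyp.1, b.cLo_hyp.2.1])

/-- `χ₂ (-·)` is antitone. [folklore] -/
theorem antitone_chiHi : Antitone b.chiHi := fun s t hst ↦
  monotone_smoothStep (by linarith [b.cUp_hyp.1, b.cUp_hyp.2.1]) (neg_le_neg hst)

/-- `χ₁ (tcLo) = 1/2`. [folklore] -/
theorem chiLo_tcLo : b.chiLo b.tcLo = 1 / 2 := by
  have h := congrArg (fun x : 𝔼 2 ↦ x 0) (b.neckLo_tcLo 0)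
  have hε := b.epsLo_bounds.1
  rw [b.neckLo_of_mem_core ⟨by linarith, by linarith⟩] at h
  simpa [chiLo] using h

/-- `χ₂ (-tcHi) = 1/2`. [folklore] -/
theorem chiHi_tcHi : b.chiHi b.tcHi = 1 / 2 := by
  have h := congrArg (fun x : 𝔼 2 ↦ x 0) (b.neckUp_tcHi 0)
  have hε := b.epsHi_bounds.1
  rw [b.neckUp_of_mem_core ⟨by linarith, by linarith⟩] at h
  simpa [chiHi] using h

/-- `χ₁` is strictly increasing on the lower core. [folklore] -/
theorem strictMonoOn_chiLo : StrictMonoOn b.chiLo (Icc (b.tcLo - b.epsLo / 8) (b.tcLo + b.epsLo / 8)) := by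
  obtain ⟨h1, h2, hε⟩ := b.tcLo_window
  exact (strictMonoOn_smoothStep (by linarith [b.cLo_hyp.2.1])).mono
    (Icc_subset_Icc (by linarith) (by linarith))

/-- `χ₂ (-·)` is strictly decreasing on the upper core. [folklore] -/
theorem strictAntiOn_chiHi : StrictAntiOn b.chiHi (Icc (b.tcHi - b.epsHi / 8) (b.tcHi + b.epsHi / 8)) := by
  obtain ⟨h1, h2, hε⟩ := b.tcHi_window
  intro s hs t ht hst
  exact (strictMonoOn_smoothStep (by linarith [b.cUp_hyp.2.1])) ⟨by linarith [ht.2], by linarith [ht.1]⟩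
    ⟨by linarith [hs.2], by linarith [hs.1]⟩ (neg_lt_neg hst)

/-- **The lower core gap**: `min (χ₁ (tcLo + ε/8) - 1/2) (1/2 - χ₁ (tcLo - ε/8)) > 0`. [folklore] -/
def gapLo : ℝ := min (b.chiLo (b.tcLo + b.epsLo / 8) - 1 / 2) (1 / 2 - b.chiLo (b.tcLo - b.epsLo / 8))

/-- **The upper core gap.** [folklore] -/
def gapHi : ℝ := min (b.chiHi (b.tcHi - b.epsHi / 8) - 1 / 2) (1 / 2 - b.chiHi (b.tcHi + b.epsHi / 8))

/-- The lower core gap is positive. [folklore] -/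
theorem gapLo_pos : 0 < b.gapLo := by
  have hε := b.epsLo_bounds.1
  have h0 := b.chiLo_tcLo
  have h1 := b.strictMonoOn_chiLo ⟨by linarith, by linarith⟩ ⟨by linarith, le_rfl⟩ (show b.tcLo < b.tcLo + b.epsLo / 8 by linarith)
  have h2 := b.strictMonoOn_chiLo ⟨le_rfl, by linarith⟩ ⟨by linarith, by linarith⟩ (show b.tcLo - b.epsLo / 8 < b.tcLo by linarith)
  rw [h0] at h1 h2
  exact lt_min (by linarith) (by linarith)

/-- The upper core gap is positive. [folklore] -/
theorem gapHi_pos : 0 < b.gapHi := by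
  have hε := b.epsHi_bounds.1
  have h0 := b.chiHi_tcHi
  have h1 := b.strictAntiOn_chiHi ⟨by linarith, by linarith⟩ ⟨by linarith, le_rfl⟩ (show b.tcHi < b.tcHi + b.epsHi / 8 by linarith)
  have h2 := b.strictAntiOn_chiHi ⟨le_rfl, by linarith⟩ ⟨by linarith, by linarith⟩ (show b.tcHi - b.epsHi / 8 < b.tcHi by linarith)
  rw [h0] at h1 h2
  exact lt_min (by linarith) (by linarith)

/-- **Localisation**: if `|χ₁ t - 1/2| < gapLo` then `t` lies in the open lower core. [folklore] -/
theorem mem_coreLo_of_abs_lt {t : ℝ} (h : |b.chiLo t - 1 / 2| < b.gapLo) :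
    t ∈ Ioo (b.tcLo - b.epsLo / 8) (b.tcLo + b.epsLo / 8) := by
  rw [abs_lt] at h
  have hg1 : b.gapLo ≤ b.chiLo (b.tcLo + b.epsLo / 8) - 1 / 2 := min_le_left _ _
  have hg2 : b.gapLo ≤ 1 / 2 - b.chiLo (b.tcLo - b.epsLo / 8) := min_le_right _ _
  constructor
  · by_contra hle
    have := b.monotone_chiLo (not_lt.1 hle)
    linarith
  · by_contra hle
    have := b.monotone_chiLo (not_lt.1 hle)
    linarith

/-- Localisation for the upper core. [folklore] -/
theorem mem_coreHi_of_abs_lt {t : ℝ} (h : |b.chiHi t - 1 / 2| < b.gapHi) :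
    t ∈ Ioo (b.tcHi - b.epsHi / 8) (b.tcHi + b.epsHi / 8) := by
  rw [abs_lt] at h
  have hg1 : b.gapHi ≤ b.chiHi (b.tcHi - b.epsHi / 8) - 1 / 2 := min_le_left _ _
  have hg2 : b.gapHi ≤ 1 / 2 - b.chiHi (b.tcHi + b.epsHi / 8) := min_le_right _ _
  constructor
  · by_contra hle
    have := b.antitone_chiHi (not_lt.1 hle)
    linarith
  · by_contra hle
    have := b.antitone_chiHi (not_lt.1 hle)
    linarith

/-- **Localisation in the blown-up parameter**: `|α t| < M` with `κ M ≤ gapLo` forces `t` into the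
open lower core. [folklore] -/
theorem mem_coreLo_of_alphaLo {κ M t : ℝ} (hκ : 0 < κ) (hM : κ * M ≤ b.gapLo) (h : |b.alphaLo κ t| < M) :
    t ∈ Ioo (b.tcLo - b.epsLo / 8) (b.tcLo + b.epsLo / 8) := by
  apply b.mem_coreLo_of_abs_lt
  have e : b.chiLo t - 1 / 2 = κ * b.alphaLo κ t := (b.mul_alphaLo hκ.ne' t).symm
  rw [e, abs_mul, abs_of_pos hκ]
  exact lt_of_lt_of_le (mul_lt_mul_of_pos_left h hκ) hM

/-- Localisation in the upper blown-up parameter. [folklore] -/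
theorem mem_coreHi_of_alphaHi {κ M t : ℝ} (hκ : 0 < κ) (hM : κ * M ≤ b.gapHi) (h : |b.alphaHi κ t| < M) :
    t ∈ Ioo (b.tcHi - b.epsHi / 8) (b.tcHi + b.epsHi / 8) := by
  apply b.mem_coreHi_of_abs_lt
  have e : b.chiHi t - 1 / 2 = κ * b.alphaHi κ t := (b.mul_alphaHi hκ.ne' t).symm
  rw [e, abs_mul, abs_of_pos hκ]
  exact lt_of_lt_of_le (mul_lt_mul_of_pos_left h hκ) hM

/-! ### The rails at scale `κ` are the necked arches on the cores -/

/-- The lower rail parameter point of `α t` is the necked lower arch point: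
`(1/2, 1/2) + (κ α t, -κ) = (χ₁ t, 1/2 - κ)`. [folklore] -/
theorem centre_add_railLoParam {κ : ℝ} (hκ : κ ≠ 0) (t : ℝ) :
    pt2 2⁻¹ 2⁻¹ + pt2 (κ * b.alphaLo κ t) (-κ) = pt2 (b.chiLo t) (1 / 2 - κ) := by
  rw [b.mul_alphaLo hκ]
  ext i; fin_cases i
  · simp
  · simp; ring

/-- The upper rail parameter point of `α t` is the necked upper arch point. [folklore] -/
theorem centre_add_railHiParam {κ : ℝ} (hκ : κ ≠ 0) (t : ℝ) :
    pt2 2⁻¹ 2⁻¹ + pt2 (κ * b.alphaHi κ t) κ = pt2 (b.chiHi t) (1 / 2 + κ) := by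
  rw [b.mul_alphaHi hκ]
  ext i; fin_cases i <;> simp

/-- On the lower core the necked lower arch (at `u = 1`, half-width `κ`) is `(χ₁ t, 1/2 - κ)`.
[folklore] -/
theorem neckLo_core {κ t : ℝ} (ht : t ∈ Icc (b.tcLo - b.epsLo / 8) (b.tcLo + b.epsLo / 8)) :
    b.neckLo κ 1 t = pt2 (b.chiLo t) (1 / 2 - κ) :=
  b.neckLo_of_mem_core ht

/-- On the upper core the necked upper arch is `(χ₂ (-t), 1/2 + κ)`. [folklore] -/
theorem neckUp_core {κ t : ℝ} (ht : t ∈ Icc (b.tcHi - b.epsHi / 8) (b.tcHi + b.epsHi / 8)) :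
    b.neckUp κ 1 t = pt2 (b.chiHi t) (1 / 2 + κ) :=
  b.neckUp_of_mem_core ht

/-- On the lower core the necked piece function is the band of `(χ₁ t, 1/2 - κ)`. [folklore] -/
theorem neckPiece_coreLo {κ t : ℝ} (ht : t ∈ Icc (b.tcLo - b.epsLo / 8) (b.tcLo + b.epsLo / 8)) :
    b.neckPiece κ 1 t = ((b.band (pt2 (b.chiLo t) (1 / 2 - κ)) : 𝕊 3) : 𝔼 4) := by
  obtain ⟨h1, h2, hε⟩ := b.tcLo_window
  rw [b.neckPiece_of_lt_tlo (by linarith [ht.2]), b.neckLo_core ht]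

/-- On the upper core the necked piece function is the band of `(χ₂ (-t), 1/2 + κ)`. [folklore] -/
theorem neckPiece_coreHi {κ t : ℝ} (ht : t ∈ Icc (b.tcHi - b.epsHi / 8) (b.tcHi + b.epsHi / 8)) :
    b.neckPiece κ 1 t = ((b.band (pt2 (b.chiHi t) (1 / 2 + κ)) : 𝕊 3) : 𝔼 4) := by
  obtain ⟨h1, h2, hε⟩ := b.tcHi_window
  rw [b.neckPiece_of_thi_le (by linarith [ht.1]) (by linarith [ht.2]), b.neckUp_core ht]

/-! ### The spiked piece function -/

/-- The new lower point on the sphere: `ψ⁻¹ (pieceLo κ σ u (α t))`. [folklore] -/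
def spikePtLo (κ σ u t : ℝ) : 𝔼 4 :=
  ((psiN.symm (b.pieceLo hcross κ σ u (b.alphaLo κ t)) : 𝕊 3) : 𝔼 4)

/-- The old lower point read back from the chart: `ψ⁻¹ (railLoPsi κ (α t))`. [folklore] -/
def railPtLo (κ t : ℝ) : 𝔼 4 := ((psiN.symm (b.railLoPsi κ (b.alphaLo κ t)) : 𝕊 3) : 𝔼 4)

/-- The new upper point on the sphere. [folklore] -/
def spikePtHi (κ σ u t : ℝ) : 𝔼 4 :=
  ((psiN.symm (b.pieceHi hcross κ σ u (b.alphaHi κ t)) : 𝕊 3) : 𝔼 4)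

/-- The old upper point read back from the chart. [folklore] -/
def railPtHi (κ t : ℝ) : 𝔼 4 := ((psiN.symm (b.railHiPsi κ (b.alphaHi κ t)) : 𝕊 3) : 𝔼 4)

/-- **The spiked piece function**: the necked piece function (neck half-width `κ`, `u = 1`) plus the
window-cut differences new-minus-old on the two cores. [folklore] -/
def spikePiece (κ σ u t : ℝ) : 𝔼 4 :=
  b.neckPiece κ 1 t + windowCut (b.alphaLo κ t) • (b.spikePtLo hcross κ σ u t - b.railPtLo κ t) +
    windowCut (b.alphaHi κ t) • (b.spikePtHi hcross κ σ u t - b.railPtHi κ t)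

/-- **The spike set**: the parameters of the two cores with blown-up parameter in `[-1, 6]`.
[folklore] -/
def spikeSet (κ : ℝ) : Set ℝ :=
  {t | t ∈ Icc (b.tcLo - b.epsLo / 8) (b.tcLo + b.epsLo / 8) ∧ b.alphaLo κ t ∈ Icc (-1 : ℝ) 6} ∪
    {t | t ∈ Icc (b.tcHi - b.epsHi / 8) (b.tcHi + b.epsHi / 8) ∧ b.alphaHi κ t ∈ Icc (-1 : ℝ) 6}

/-- The spike set is closed. [folklore] -/
theorem isClosed_spikeSet (κ : ℝ) : IsClosed (b.spikeSet κ) :=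
  ((isClosed_Icc.preimage continuous_id).inter (isClosed_Icc.preimage (b.contDiff_alphaLo κ).continuous)).union
    ((isClosed_Icc.preimage continuous_id).inter (isClosed_Icc.preimage (b.contDiff_alphaHi κ).continuous))

/-- The spike set lies in the two cores, hence in the neck set. [folklore] -/
theorem spikeSet_subset_neckSet (κ : ℝ) : b.spikeSet κ ⊆ b.neckSet := by
  have hε := b.epsLo_bounds.1
  have hε' := b.epsHi_bounds.1
  rintro t (⟨ht, -⟩ | ⟨ht, -⟩)
  · exact Or.inl ⟨by linarith [ht.1], by linarith [ht.2]⟩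
  · exact Or.inr ⟨by linarith [ht.1], by linarith [ht.2]⟩

/-- The spike set lies in `[alo + seamEps, alo + 1 - seamEps]`. [folklore] -/
theorem spikeSet_subset (κ : ℝ) : b.spikeSet κ ⊆ Icc (b.alo + b.seamEps) (b.alo + 1 - b.seamEps) :=
  (b.spikeSet_subset_neckSet κ).trans b.neckSet_subset

/-! ### The chart inverse composed with the inclusion -/

omit b in
/-- `y ↦ ψ⁻¹ y ∈ ℝ⁴` is `C^∞`. [folklore] -/
theorem contDiff_coe_psiN_symm : ContDiff ℝ ∞ (fun y : 𝔼 3 ↦ ((psiN.symm y : 𝕊 3) : 𝔼 4)) := by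
  have h := (contMDiff_coe_sphere (E := 𝔼 4) (n := 3) (m := ∞)).comp contMDiff_psiN_symm
  exact contMDiff_iff_contDiff.1 h

omit b in
/-- **The differential of `y ↦ ψ⁻¹ y ∈ ℝ⁴` is injective** (chart inverse and inclusion are
immersions). [folklore] -/
theorem fderiv_coe_psiN_symm_injective (y : 𝔼 3) :
    Injective (fderiv ℝ (fun y : 𝔼 3 ↦ ((psiN.symm y : 𝕊 3) : 𝔼 4)) y) := by
  have hn : (∞ : ℕ∞ω) ≠ 0 := by simp
  have hψ : MDifferentiableAt 𝓘(ℝ, 𝔼 3) (𝓡 3) psiN.symm y := (contMDiff_psiN_symm y).mdifferentiableAt hn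
  have hc : MDifferentiableAt (𝓡 3) 𝓘(ℝ, 𝔼 4) (fun x : 𝕊 3 ↦ (x : 𝔼 4)) (psiN.symm y) :=
    ((contMDiff_coe_sphere (E := 𝔼 4) (n := 3) (m := ∞)) _).mdifferentiableAt hn
  have hmd : psiN.MDifferentiable (𝓡 3) 𝓘(ℝ, 𝔼 3) :=
    ⟨contMDiffOn_psiN.mdifferentiableOn hn, (contMDiff_psiN_symm.contMDiffOn (s := psiN.target)).mdifferentiableOn hn⟩
  have hinj : Injective (mfderiv 𝓘(ℝ, 𝔼 3) (𝓡 3) psiN.symm y) :=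
    hmd.symm.mfderiv_injective (show y ∈ psiN.symm.source by rw [psiN.symm_source, psiN_target]; trivial)
  intro v w hvw
  rw [fderiv_comp_sphere_apply hc hψ, fderiv_comp_sphere_apply hc hψ] at hvw
  exact hinj (mfderiv_coe_sphere_injective (n := 3) (psiN.symm y) hvw)

omit b in
/-- A curve through the chart inverse with nonzero velocity has nonzero velocity in `ℝ⁴`.
[folklore] -/
theorem deriv_coe_psiN_symm_comp_ne_zero {c : ℝ → 𝔼 3} {t : ℝ} {W : 𝔼 3} (hc : HasDerivAt c W t) (hW : W ≠ 0) :
    deriv (fun s ↦ ((psiN.symm (c s) : 𝕊 3) : 𝔼 4)) t ≠ 0 := by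
  have hd := ((contDiff_coe_psiN_symm.differentiable (by simp)) (c t)).hasFDerivAt.comp_hasDerivAt t hc
  have e : (fun s ↦ ((psiN.symm (c s) : 𝕊 3) : 𝔼 4)) = (fun y : 𝔼 3 ↦ ((psiN.symm y : 𝕊 3) : 𝔼 4)) ∘ c := rfl
  rw [e, hd.deriv]
  intro h
  exact hW (fderiv_coe_psiN_symm_injective (c t) (h.trans (map_zero _).symm))

/-! ### The spiked piece function on the cores -/

section Core

variable {κ : ℝ} (hκ : 0 < κ) (hκ12 : κ ≤ 1 / 12) (h8 : 8 * κ ≤ b.poleRad hcross)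
include hκ

/-- On the lower core, with `|α t| < 7` and `8κ ≤ poleRad`, the rail parameter point is pole-free.
[folklore] -/
theorem norm_railLoParam_alphaLo_lt (h8 : 8 * κ ≤ b.poleRad hcross) {t : ℝ} (hα : |b.alphaLo κ t| < 7) :
    ‖(pt2 (κ * b.alphaLo κ t) (-κ) : 𝔼 2)‖ < b.poleRad hcross := by
  have h := norm_railParam_le hκ (b.alphaLo κ t) (-1) (by simp)
  rw [neg_one_mul] at h
  have : κ * (|b.alphaLo κ t| + 1) < 8 * κ := by nlinarith
  linarith

/-- On the upper core, with `|α t| < 7` and `8κ ≤ poleRad`, the rail parameter point is pole-free.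
[folklore] -/
theorem norm_railHiParam_alphaHi_lt (h8 : 8 * κ ≤ b.poleRad hcross) {t : ℝ} (hα : |b.alphaHi κ t| < 7) :
    ‖(pt2 (κ * b.alphaHi κ t) κ : 𝔼 2)‖ < b.poleRad hcross := by
  have h := norm_railParam_le hκ (b.alphaHi κ t) 1 (by simp)
  rw [one_mul] at h
  have : κ * (|b.alphaHi κ t| + 1) < 8 * κ := by nlinarith
  linarith

include h8 in
/-- **On the lower core the old point read back from the chart is the necked piece function.**
[folklore] -/
theorem railPtLo_eq_neckPiece {t : ℝ} (ht : t ∈ Icc (b.tcLo - b.epsLo / 8) (b.tcLo + b.epsLo / 8))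
    (hα : |b.alphaLo κ t| < 7) : b.railPtLo κ t = b.neckPiece κ 1 t := by
  have hne := b.band_ne_northPole_of_norm_lt hcross (b.norm_railLoParam_alphaLo_lt hcross hκ h8 hα)
  rw [railPtLo, railLoPsi, Fband, psiN_symm_apply_psiN hne, b.centre_add_railLoParam hκ.ne',
    b.neckPiece_coreLo ht]

include h8 in
/-- On the upper core the old point read back from the chart is the necked piece function.
[folklore] -/
theorem railPtHi_eq_neckPiece {t : ℝ} (ht : t ∈ Icc (b.tcHi - b.epsHi / 8) (b.tcHi + b.epsHi / 8))
    (hα : |b.alphaHi κ t| < 7) : b.railPtHi κ t = b.neckPiece κ 1 t := by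
  have hne := b.band_ne_northPole_of_norm_lt hcross (b.norm_railHiParam_alphaHi_lt hcross hκ h8 hα)
  rw [railPtHi, railHiPsi, Fband, psiN_symm_apply_psiN hne, b.centre_add_railHiParam hκ.ne',
    b.neckPiece_coreHi ht]

include hκ12 in
/-- Left of `thi` (in particular on the lower core) the upper window cut-off vanishes: there
`χ₂ (-t) = 1`, so `α = 1/(2κ) ≥ 6`. [folklore] -/
theorem windowCut_alphaHi_eq_zero {t : ℝ} (ht : t ≤ b.thi) : windowCut (b.alphaHi κ t) = 0 := by
  have hε' := b.epsHi_bounds.1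
  have hχ : b.chiHi t = 1 := smoothStep_of_ge (by linarith [b.cUp_hyp.1, b.cUp_hyp.2.1]) (by linarith)
  apply windowCut_eq_zero
  intro h
  have : b.alphaHi κ t = 1 / (2 * κ) := by rw [alphaHi, hχ]; field_simp; ring
  rw [this] at h
  have h6 : (6 : ℝ) ≤ 1 / (2 * κ) := by rw [le_div_iff₀ (by positivity)]; linarith
  linarith [h.2]

include hκ12 in
/-- Right of `tlo` (in particular on the upper core) the lower window cut-off vanishes. [folklore] -/
theorem windowCut_alphaLo_eq_zero {t : ℝ} (ht : b.tlo ≤ t) : windowCut (b.alphaLo κ t) = 0 := by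
  have hε := b.epsLo_bounds.1
  have hχ : b.chiLo t = 1 := smoothStep_of_ge (by linarith [b.cLo_hyp.1, b.cLo_hyp.2.1]) (by linarith)
  apply windowCut_eq_zero
  intro h
  have : b.alphaLo κ t = 1 / (2 * κ) := by rw [alphaLo, hχ]; field_simp; ring
  rw [this] at h
  have h6 : (6 : ℝ) ≤ 1 / (2 * κ) := by rw [le_div_iff₀ (by positivity)]; linarith
  linarith [h.2]

include hκ12 h8 in
/-- **On the lower core (with `|α t| < 7`) the spiked piece function is the new lower point.**
[folklore] -/
theorem spikePiece_coreLo (σ u : ℝ) {t : ℝ} (ht : t ∈ Icc (b.tcLo - b.epsLo / 8) (b.tcLo + b.epsLo / 8))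
    (hα : |b.alphaLo κ t| < 7) : b.spikePiece hcross κ σ u t = b.spikePtLo hcross κ σ u t := by
  have hm := b.marks_lt
  obtain ⟨h1, h2, hε⟩ := b.tcLo_window
  rw [spikePiece, b.windowCut_alphaHi_eq_zero hκ hκ12 (by linarith [ht.2]), zero_smul, add_zero,
    b.railPtLo_eq_neckPiece hcross hκ h8 ht hα]
  by_cases hc : windowCut (b.alphaLo κ t) = 1
  · rw [hc, one_smul]; abel
  · have hβ := spikeBump_eq_zero_of_windowCut_ne_one hc
    have he : b.spikePtLo hcross κ σ u t = b.neckPiece κ 1 t := by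
      rw [← b.railPtLo_eq_neckPiece hcross hκ h8 ht hα, spikePtLo, railPtLo, pieceLo, hβ]
      simp
    rw [he, sub_self, smul_zero, add_zero]

include hκ12 h8 in
/-- On the upper core (with `|α t| < 7`) the spiked piece function is the new upper point.
[folklore] -/
theorem spikePiece_coreHi (σ u : ℝ) {t : ℝ} (ht : t ∈ Icc (b.tcHi - b.epsHi / 8) (b.tcHi + b.epsHi / 8))
    (hα : |b.alphaHi κ t| < 7) : b.spikePiece hcross κ σ u t = b.spikePtHi hcross κ σ u t := by
  have hm := b.marks_lt
  obtain ⟨h1, h2, hε⟩ := b.tcHi_window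
  rw [spikePiece, b.windowCut_alphaLo_eq_zero hκ hκ12 (by linarith [ht.1]), zero_smul, add_zero,
    b.railPtHi_eq_neckPiece hcross hκ h8 ht hα]
  by_cases hc : windowCut (b.alphaHi κ t) = 1
  · rw [hc, one_smul]; abel
  · have hβ := spikeBump_eq_zero_of_windowCut_ne_one hc
    have he : b.spikePtHi hcross κ σ u t = b.neckPiece κ 1 t := by
      rw [← b.railPtHi_eq_neckPiece hcross hκ h8 ht hα, spikePtHi, railPtHi, pieceHi, hβ]
      simp
    rw [he, sub_self, smul_zero, add_zero]

/-- **Off the spike set the spiked piece function is the necked piece function** (where a window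
cut-off is nonzero, the blown-up parameter is in `(-1, 6)`, which by localisation puts `t` in the
corresponding core, hence in the spike set). [folklore] -/
theorem spikePiece_eq_neckPiece (h7 : 7 * κ ≤ b.gapLo) (h7' : 7 * κ ≤ b.gapHi) (σ u : ℝ) {t : ℝ}
    (ht : t ∉ b.spikeSet κ) : b.spikePiece hcross κ σ u t = b.neckPiece κ 1 t := by
  have hlo : windowCut (b.alphaLo κ t) = 0 := by
    by_contra hne
    have hα : b.alphaLo κ t ∈ Ioo (-1 : ℝ) 6 := by
      by_contra hmem; exact hne (windowCut_eq_zero hmem)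
    have hcore := b.mem_coreLo_of_alphaLo hκ (M := 7) (by linarith) (abs_lt.2 ⟨by linarith [hα.1], by linarith [hα.2]⟩)
    exact ht (Or.inl ⟨Ioo_subset_Icc_self hcore, ⟨hα.1.le, hα.2.le⟩⟩)
  have hhi : windowCut (b.alphaHi κ t) = 0 := by
    by_contra hne
    have hα : b.alphaHi κ t ∈ Ioo (-1 : ℝ) 6 := by
      by_contra hmem; exact hne (windowCut_eq_zero hmem)
    have hcore := b.mem_coreHi_of_alphaHi hκ (M := 7) (by linarith) (abs_lt.2 ⟨by linarith [hα.1], by linarith [hα.2]⟩)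
    exact ht (Or.inr ⟨Ioo_subset_Icc_self hcore, ⟨hα.1.le, hα.2.le⟩⟩)
  rw [spikePiece, hlo, hhi, zero_smul, zero_smul, add_zero, add_zero]

end Core

/-- **At `u = 0` the spiked piece function is the necked piece function.** [folklore] -/
theorem spikePiece_zero (κ σ t : ℝ) : b.spikePiece hcross κ σ 0 t = b.neckPiece κ 1 t := by
  simp [spikePiece, spikePtLo, spikePtHi, railPtLo, railPtHi]

/-- Members of the lower spike set have `|α t| < 7`. [folklore] -/
theorem abs_alphaLo_lt_of_mem {κ t : ℝ} (h : b.alphaLo κ t ∈ Icc (-1 : ℝ) 6) : |b.alphaLo κ t| < 7 :=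
  abs_lt.2 ⟨by linarith [h.1], by linarith [h.2]⟩

/-- Members of the upper spike set have `|α t| < 7`. [folklore] -/
theorem abs_alphaHi_lt_of_mem {κ t : ℝ} (h : b.alphaHi κ t ∈ Icc (-1 : ℝ) 6) : |b.alphaHi κ t| < 7 :=
  abs_lt.2 ⟨by linarith [h.1], by linarith [h.2]⟩

/-- **The spiked piece function is a unit vector on the spike set.** [folklore] -/
theorem norm_spikePiece {κ : ℝ} (hκ : 0 < κ) (hκ12 : κ ≤ 1 / 12) (h8 : 8 * κ ≤ b.poleRad hcross) (σ u : ℝ)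
    {t : ℝ} (ht : t ∈ b.spikeSet κ) : ‖b.spikePiece hcross κ σ u t‖ = 1 := by
  rcases ht with ⟨ht, hα⟩ | ⟨ht, hα⟩
  · rw [b.spikePiece_coreLo hcross hκ hκ12 h8 σ u ht (b.abs_alphaLo_lt_of_mem hα), spikePtLo]
    exact norm_eq_of_mem_sphere _
  · rw [b.spikePiece_coreHi hcross hκ hκ12 h8 σ u ht (b.abs_alphaHi_lt_of_mem hα), spikePtHi]
    exact norm_eq_of_mem_sphere _

/-! ### Smoothness of the spiked piece function -/

/-- The new lower point is jointly `C^∞` in `(u, t)` where `|α t| < 7` (and `8κ ≤ poleRad`).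
[folklore] -/
theorem contDiffAt_spikePtLo {κ : ℝ} (hκ : 0 < κ) (h8 : 8 * κ ≤ b.poleRad hcross) (σ : ℝ) {u t : ℝ}
    (hα : |b.alphaLo κ t| < 7) : ContDiffAt ℝ ∞ (uncurry (b.spikePtLo hcross κ σ)) (u, t) := by
  have h1 : ContDiffAt ℝ ∞ (fun p : ℝ × ℝ ↦ (p.1, b.alphaLo κ p.2)) (u, t) :=
    (contDiffAt_fst.prodMk ((b.contDiff_alphaLo κ).contDiffAt.comp _ contDiffAt_snd))
  have h2 : ContDiffAt ℝ ∞ (uncurry (b.pieceLo hcross κ σ)) (u, b.alphaLo κ t) :=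
    b.contDiffAt_pieceLo σ (b.norm_railLoParam_alphaLo_lt hcross hκ h8 hα)
  have h3 := contDiff_coe_psiN_symm.contDiffAt.comp (u, t) (h2.comp (u, t) h1)
  exact h3

/-- The new upper point is jointly `C^∞` in `(u, t)` where `|α t| < 7`. [folklore] -/
theorem contDiffAt_spikePtHi {κ : ℝ} (hκ : 0 < κ) (h8 : 8 * κ ≤ b.poleRad hcross) (σ : ℝ) {u t : ℝ}
    (hα : |b.alphaHi κ t| < 7) : ContDiffAt ℝ ∞ (uncurry (b.spikePtHi hcross κ σ)) (u, t) := by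
  have h1 : ContDiffAt ℝ ∞ (fun p : ℝ × ℝ ↦ (p.1, b.alphaHi κ p.2)) (u, t) :=
    (contDiffAt_fst.prodMk ((b.contDiff_alphaHi κ).contDiffAt.comp _ contDiffAt_snd))
  have h2 : ContDiffAt ℝ ∞ (uncurry (b.pieceHi hcross κ σ)) (u, b.alphaHi κ t) :=
    b.contDiffAt_pieceHi σ (b.norm_railHiParam_alphaHi_lt hcross hκ h8 hα)
  have h3 := contDiff_coe_psiN_symm.contDiffAt.comp (u, t) (h2.comp (u, t) h1)
  exact h3

/-- The old lower point is `C^∞` in `t` where `|α t| < 7`. [folklore] -/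
theorem contDiffAt_railPtLo {κ : ℝ} (hκ : 0 < κ) (h8 : 8 * κ ≤ b.poleRad hcross) {t : ℝ}
    (hα : |b.alphaLo κ t| < 7) : ContDiffAt ℝ ∞ (b.railPtLo κ) t := by
  have h := (b.contDiffAt_spikePtLo hcross hκ h8 0 (u := 0) hα).comp t
    ((contDiffAt_const (c := (0 : ℝ))).prodMk contDiffAt_id)
  have e : uncurry (b.spikePtLo hcross κ 0) ∘ (fun t : ℝ ↦ ((0 : ℝ), t)) = b.railPtLo κ := by
    funext s; simp [spikePtLo, railPtLo]
  rwa [e] at h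

/-- The old upper point is `C^∞` in `t` where `|α t| < 7`. [folklore] -/
theorem contDiffAt_railPtHi {κ : ℝ} (hκ : 0 < κ) (h8 : 8 * κ ≤ b.poleRad hcross) {t : ℝ}
    (hα : |b.alphaHi κ t| < 7) : ContDiffAt ℝ ∞ (b.railPtHi κ) t := by
  have h := (b.contDiffAt_spikePtHi hcross hκ h8 0 (u := 0) hα).comp t
    ((contDiffAt_const (c := (0 : ℝ))).prodMk contDiffAt_id)
  have e : uncurry (b.spikePtHi hcross κ 0) ∘ (fun t : ℝ ↦ ((0 : ℝ), t)) = b.railPtHi κ := by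
    funext s; simp [spikePtHi, railPtHi]
  rwa [e] at h

/-- **The spiked piece function is jointly `C^∞` in `(u, t)`** (near points with `|α t| < 7` all
terms are smooth; elsewhere the window cut-off vanishes identically nearby). [folklore] -/
theorem contDiff_spikePiece {κ : ℝ} (hκ : 0 < κ) (h8 : 8 * κ ≤ b.poleRad hcross) (σ : ℝ) :
    ContDiff ℝ ∞ (uncurry (b.spikePiece hcross κ σ)) := by
  have hN : ContDiff ℝ ∞ (fun p : ℝ × ℝ ↦ b.neckPiece κ 1 p.2) :=
    (b.contDiff_neckPiece κ).comp (contDiff_const.prodMk contDiff_snd)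
  have hLo : ContDiff ℝ ∞ (fun p : ℝ × ℝ ↦ windowCut (b.alphaLo κ p.2) • (b.spikePtLo hcross κ σ p.1 p.2 - b.railPtLo κ p.2)) := by
    rw [contDiff_iff_contDiffAt]
    rintro ⟨u, t⟩
    by_cases hα : |b.alphaLo κ t| < 7
    · have hc : ContDiffAt ℝ ∞ (fun p : ℝ × ℝ ↦ windowCut (b.alphaLo κ p.2)) (u, t) :=
        (contDiff_windowCut.comp ((b.contDiff_alphaLo κ).comp contDiff_snd)).contDiffAt
      have hr : ContDiffAt ℝ ∞ (b.railPtLo κ ∘ Prod.snd) (u, t) :=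
        ContDiffAt.comp (g := b.railPtLo κ) (f := Prod.snd) (u, t) (b.contDiffAt_railPtLo hcross hκ h8 hα) contDiffAt_snd
      exact hc.smul ((b.contDiffAt_spikePtLo hcross hκ h8 σ hα).sub hr)
    · -- the cut-off vanishes near `(u, t)`
      have hopen : IsOpen {p : ℝ × ℝ | 6 < |b.alphaLo κ p.2|} :=
        isOpen_lt continuous_const (continuous_abs.comp ((b.contDiff_alphaLo κ).continuous.comp continuous_snd))
      have hmem : (u, t) ∈ {p : ℝ × ℝ | 6 < |b.alphaLo κ p.2|} := by
        simp only [mem_setOf_eq]; linarith [not_lt.1 hα]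
      refine (contDiffAt_const (c := (0 : 𝔼 4))).congr_of_eventuallyEq ?_
      filter_upwards [hopen.mem_nhds hmem] with p hp
      have : windowCut (b.alphaLo κ p.2) = 0 := by
        apply windowCut_eq_zero
        intro h
        have := abs_lt.2 ⟨by linarith [h.1], h.2⟩
        exact absurd hp (by simp only [not_lt]; linarith)
      simp [this]
  have hHi : ContDiff ℝ ∞ (fun p : ℝ × ℝ ↦ windowCut (b.alphaHi κ p.2) • (b.spikePtHi hcross κ σ p.1 p.2 - b.railPtHi κ p.2)) := by
    rw [contDiff_iff_contDiffAt]
    rintro ⟨u, t⟩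
    by_cases hα : |b.alphaHi κ t| < 7
    · have hc : ContDiffAt ℝ ∞ (fun p : ℝ × ℝ ↦ windowCut (b.alphaHi κ p.2)) (u, t) :=
        (contDiff_windowCut.comp ((b.contDiff_alphaHi κ).comp contDiff_snd)).contDiffAt
      have hr : ContDiffAt ℝ ∞ (b.railPtHi κ ∘ Prod.snd) (u, t) :=
        ContDiffAt.comp (g := b.railPtHi κ) (f := Prod.snd) (u, t) (b.contDiffAt_railPtHi hcross hκ h8 hα) contDiffAt_snd
      exact hc.smul ((b.contDiffAt_spikePtHi hcross hκ h8 σ hα).sub hr)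
    · have hopen : IsOpen {p : ℝ × ℝ | 6 < |b.alphaHi κ p.2|} :=
        isOpen_lt continuous_const (continuous_abs.comp ((b.contDiff_alphaHi κ).continuous.comp continuous_snd))
      have hmem : (u, t) ∈ {p : ℝ × ℝ | 6 < |b.alphaHi κ p.2|} := by
        simp only [mem_setOf_eq]; linarith [not_lt.1 hα]
      refine (contDiffAt_const (c := (0 : 𝔼 4))).congr_of_eventuallyEq ?_
      filter_upwards [hopen.mem_nhds hmem] with p hp
      have : windowCut (b.alphaHi κ p.2) = 0 := by
        apply windowCut_eq_zero
        intro h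
        have := abs_lt.2 ⟨by linarith [h.1], h.2⟩
        exact absurd hp (by simp only [not_lt]; linarith)
      simp [this]
  have e : uncurry (b.spikePiece hcross κ σ) = fun p : ℝ × ℝ ↦ b.neckPiece κ 1 p.2 +
      windowCut (b.alphaLo κ p.2) • (b.spikePtLo hcross κ σ p.1 p.2 - b.railPtLo κ p.2) +
      windowCut (b.alphaHi κ p.2) • (b.spikePtHi hcross κ σ p.1 p.2 - b.railPtHi κ p.2) := by
    funext p; rfl
  rw [e]
  exact (hN.add hLo).add hHi

/-- Each stage of the spiked piece function is `C^∞`. [folklore] -/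
theorem contDiff_spikePiece_stage {κ : ℝ} (hκ : 0 < κ) (h8 : 8 * κ ≤ b.poleRad hcross) (σ u : ℝ) :
    ContDiff ℝ ∞ (b.spikePiece hcross κ σ u) :=
  (b.contDiff_spikePiece hcross hκ h8 σ).comp ((contDiff_const (c := u)).prodMk (contDiff_id (E := ℝ)))

/-! ### Derivatives of the blown-up parameters -/

/-- The lower blown-up parameter has derivative `χ₁' t / κ`. [folklore] -/
theorem hasDerivAt_alphaLo (κ t : ℝ) : HasDerivAt (b.alphaLo κ) (deriv b.chiLo t / κ) t := by
  have h := ((b.contDiff_chiLo.differentiable (by simp)) t).hasDerivAt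
  exact (h.sub_const _).div_const κ

/-- The upper blown-up parameter has derivative `χ' t / κ` with `χ = chiHi`. [folklore] -/
theorem hasDerivAt_alphaHi (κ t : ℝ) : HasDerivAt (b.alphaHi κ) (deriv b.chiHi t / κ) t := by
  have h := ((b.contDiff_chiHi.differentiable (by simp)) t).hasDerivAt
  exact (h.sub_const _).div_const κ

/-- On the lower core `χ₁' > 0`. [folklore] -/
theorem deriv_chiLo_pos {t : ℝ} (ht : t ∈ Icc (b.tcLo - b.epsLo / 8) (b.tcLo + b.epsLo / 8)) : 0 < deriv b.chiLo t := by
  obtain ⟨h1, h2, hε⟩ := b.tcLo_window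
  exact deriv_smoothStep_pos (by linarith [b.cLo_hyp.2.1]) ⟨by linarith [ht.1], by linarith [ht.2]⟩

/-- On the upper core `χ' < 0` for `χ = chiHi`. [folklore] -/
theorem deriv_chiHi_neg {t : ℝ} (ht : t ∈ Icc (b.tcHi - b.epsHi / 8) (b.tcHi + b.epsHi / 8)) : deriv b.chiHi t < 0 := by
  obtain ⟨h1, h2, hε⟩ := b.tcHi_window
  have hab : -b.ahi + b.epsHi < -b.thi - b.epsHi := by linarith [b.cUp_hyp.2.1]
  have hd : HasDerivAt b.chiHi (deriv (smoothStep (-b.ahi + b.epsHi) (-b.thi - b.epsHi)) (-t) * (-1)) t := by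
    have h := ((differentiable_smoothStep (-b.ahi + b.epsHi) (-b.thi - b.epsHi)) (-t)).hasDerivAt
    exact h.comp t (hasDerivAt_neg t)
  rw [hd.deriv]
  have hpos := deriv_smoothStep_pos hab (x := -t) ⟨by linarith [ht.2], by linarith [ht.1]⟩
  linarith

/-- The lower blown-up parameter is strictly increasing on the lower core (for `κ > 0`).
[folklore] -/
theorem strictMonoOn_alphaLo {κ : ℝ} (hκ : 0 < κ) :
    StrictMonoOn (b.alphaLo κ) (Icc (b.tcLo - b.epsLo / 8) (b.tcLo + b.epsLo / 8)) := fun s hs t ht hst ↦ by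
  simp only [alphaLo]
  exact div_lt_div_of_pos_right (by linarith [b.strictMonoOn_chiLo hs ht hst]) hκ

/-- The upper blown-up parameter is strictly decreasing on the upper core. [folklore] -/
theorem strictAntiOn_alphaHi {κ : ℝ} (hκ : 0 < κ) :
    StrictAntiOn (b.alphaHi κ) (Icc (b.tcHi - b.epsHi / 8) (b.tcHi + b.epsHi / 8)) := fun s hs t ht hst ↦ by
  simp only [alphaHi]
  exact div_lt_div_of_pos_right (by linarith [b.strictAntiOn_chiHi hs ht hst]) hκ

/-! ### Regularity and injectivity on the spike set in the flat regime -/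

section Flat

variable {hcross} {ε r κ : ℝ} (hf : b.IsFlat hcross ε r) (hκ : 0 < κ) (hκ12 : κ ≤ 1 / 12)
  (h8 : 8 * κ ≤ b.poleRad hcross) (h8r : 8 * κ < r) (h7 : 7 * κ ≤ b.gapLo) (h7' : 7 * κ ≤ b.gapHi)
  (hgood : ε * (1 + bumpBound * 8) ≤ 1 / 2) (hε56 : ε * 8 ≤ 5 / 6)
include hκ

omit b in
/-- Scale condition from `|α| < 7` and `8κ < r`. [folklore] -/
theorem scale_of_abs_lt {α : ℝ} (h8r : 8 * κ < r) (hα : |α| < 7) : κ * (|α| + 1) < r := by nlinarith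

include h7 in
/-- A member of the lower spike set lies in the open lower core. [folklore] -/
theorem mem_openCoreLo {t : ℝ} (ht : b.alphaLo κ t ∈ Icc (-1 : ℝ) 6) :
    t ∈ Ioo (b.tcLo - b.epsLo / 8) (b.tcLo + b.epsLo / 8) :=
  b.mem_coreLo_of_alphaLo hκ (M := 7) (by linarith) (b.abs_alphaLo_lt_of_mem ht)

include h7' in
/-- A member of the upper spike set lies in the open upper core. [folklore] -/
theorem mem_openCoreHi {t : ℝ} (ht : b.alphaHi κ t ∈ Icc (-1 : ℝ) 6) :
    t ∈ Ioo (b.tcHi - b.epsHi / 8) (b.tcHi + b.epsHi / 8) :=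
  b.mem_coreHi_of_alphaHi hκ (M := 7) (by linarith) (b.abs_alphaHi_lt_of_mem ht)

include hκ12 h8 h7 in
/-- Near a member of the lower spike set the spiked piece function is the new lower point.
[folklore] -/
theorem spikePiece_eventuallyEq_lo (σ u : ℝ) {t : ℝ} (ht : b.alphaLo κ t ∈ Icc (-1 : ℝ) 6) :
    b.spikePiece hcross κ σ u =ᶠ[𝓝 t] b.spikePtLo hcross κ σ u := by
  have hcore := b.mem_openCoreLo hκ h7 ht
  have hopen : IsOpen (Ioo (b.tcLo - b.epsLo / 8) (b.tcLo + b.epsLo / 8) ∩ {s | |b.alphaLo κ s| < 7}) :=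
    isOpen_Ioo.inter (isOpen_lt (continuous_abs.comp (b.contDiff_alphaLo κ).continuous) continuous_const)
  filter_upwards [hopen.mem_nhds ⟨hcore, b.abs_alphaLo_lt_of_mem ht⟩] with s hs
  exact b.spikePiece_coreLo hcross hκ hκ12 h8 σ u (Ioo_subset_Icc_self hs.1) hs.2

include hκ12 h8 h7' in
/-- Near a member of the upper spike set the spiked piece function is the new upper point.
[folklore] -/
theorem spikePiece_eventuallyEq_hi (σ u : ℝ) {t : ℝ} (ht : b.alphaHi κ t ∈ Icc (-1 : ℝ) 6) :
    b.spikePiece hcross κ σ u =ᶠ[𝓝 t] b.spikePtHi hcross κ σ u := by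
  have hcore := b.mem_openCoreHi hκ h7' ht
  have hopen : IsOpen (Ioo (b.tcHi - b.epsHi / 8) (b.tcHi + b.epsHi / 8) ∩ {s | |b.alphaHi κ s| < 7}) :=
    isOpen_Ioo.inter (isOpen_lt (continuous_abs.comp (b.contDiff_alphaHi κ).continuous) continuous_const)
  filter_upwards [hopen.mem_nhds ⟨hcore, b.abs_alphaHi_lt_of_mem ht⟩] with s hs
  exact b.spikePiece_coreHi hcross hκ hκ12 h8 σ u (Ioo_subset_Icc_self hs.1) hs.2

include hf h8 h8r hgood in
/-- The velocity of the new lower point is nonzero on the lower spike set (for `u ∈ [0, 1]`).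
[folklore] -/
theorem deriv_spikePtLo_ne_zero {σ u : ℝ} (hu : u ∈ Icc (0 : ℝ) 1) {t : ℝ} (ht : b.alphaLo κ t ∈ Icc (-1 : ℝ) 6)
    (hcore : t ∈ Icc (b.tcLo - b.epsLo / 8) (b.tcLo + b.epsLo / 8)) :
    deriv (b.spikePtLo hcross κ σ u) t ≠ 0 := by
  have hα7 := b.abs_alphaLo_lt_of_mem ht
  have hsc : κ * (|b.alphaLo κ t| + 1) < r := scale_of_abs_lt hκ h8r hα7
  -- the derivative of the piece at `α t`
  have hpd : DifferentiableAt ℝ (b.pieceLo hcross κ σ u) (b.alphaLo κ t) := by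
    have h := (b.contDiffAt_pieceLo σ (u := u) (b.norm_railLoParam_alphaLo_lt hcross hκ h8 hα7)).comp
      (b.alphaLo κ t) ((contDiffAt_const (c := u)).prodMk contDiffAt_id)
    exact h.differentiableAt (by simp)
  set W := deriv (b.pieceLo hcross κ σ u) (b.alphaLo κ t)
  have hW : HasDerivAt (b.pieceLo hcross κ σ u) W (b.alphaLo κ t) := hpd.hasDerivAt
  have hWne : W ≠ 0 := b.ne_zero_of_hasDerivAt_pieceLo hf hκ hu hsc (by
    have hε := hf.eps_nonneg; have hB := bumpBound_spec.1
    nlinarith [mul_nonneg (mul_nonneg hε hB) (by linarith : (0:ℝ) ≤ 7 - |b.alphaLo κ t|)]) hW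
  have hc : HasDerivAt (fun s ↦ b.pieceLo hcross κ σ u (b.alphaLo κ s)) ((deriv b.chiLo t / κ) • W) t :=
    hW.scomp t (b.hasDerivAt_alphaLo κ t)
  have hne : (deriv b.chiLo t / κ) • W ≠ 0 :=
    smul_ne_zero (div_pos (b.deriv_chiLo_pos hcore) hκ).ne' hWne
  exact deriv_coe_psiN_symm_comp_ne_zero hc hne

include hf h8 h8r hgood in
/-- The velocity of the new upper point is nonzero on the upper spike set. [folklore] -/
theorem deriv_spikePtHi_ne_zero {σ u : ℝ} (hu : u ∈ Icc (0 : ℝ) 1) {t : ℝ} (ht : b.alphaHi κ t ∈ Icc (-1 : ℝ) 6)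
    (hcore : t ∈ Icc (b.tcHi - b.epsHi / 8) (b.tcHi + b.epsHi / 8)) :
    deriv (b.spikePtHi hcross κ σ u) t ≠ 0 := by
  have hα7 := b.abs_alphaHi_lt_of_mem ht
  have hsc : κ * (|b.alphaHi κ t| + 1) < r := scale_of_abs_lt hκ h8r hα7
  have hpd : DifferentiableAt ℝ (b.pieceHi hcross κ σ u) (b.alphaHi κ t) := by
    have h := (b.contDiffAt_pieceHi σ (u := u) (b.norm_railHiParam_alphaHi_lt hcross hκ h8 hα7)).comp
      (b.alphaHi κ t) ((contDiffAt_const (c := u)).prodMk contDiffAt_id)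
    exact h.differentiableAt (by simp)
  set W := deriv (b.pieceHi hcross κ σ u) (b.alphaHi κ t)
  have hW : HasDerivAt (b.pieceHi hcross κ σ u) W (b.alphaHi κ t) := hpd.hasDerivAt
  have hWne : W ≠ 0 := b.ne_zero_of_hasDerivAt_pieceHi hf hκ hu hsc (by
    have hε := hf.eps_nonneg; have hB := bumpBound_spec.1
    nlinarith [mul_nonneg (mul_nonneg hε hB) (by linarith : (0:ℝ) ≤ 7 - |b.alphaHi κ t|)]) hW
  have hc : HasDerivAt (fun s ↦ b.pieceHi hcross κ σ u (b.alphaHi κ s)) ((deriv b.chiHi t / κ) • W) t :=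
    hW.scomp t (b.hasDerivAt_alphaHi κ t)
  have hne : (deriv b.chiHi t / κ) • W ≠ 0 :=
    smul_ne_zero (div_neg_of_neg_of_pos (b.deriv_chiHi_neg hcore) hκ).ne hWne
  exact deriv_coe_psiN_symm_comp_ne_zero hc hne

include hf hκ12 h8 h8r h7 h7' hgood in
/-- **The spiked piece function is regular on the spike set** (for `u ∈ [0, 1]`). [folklore] -/
theorem deriv_spikePiece_ne_zero {σ u : ℝ} (hu : u ∈ Icc (0 : ℝ) 1) {t : ℝ} (ht : t ∈ b.spikeSet κ) :
    deriv (b.spikePiece hcross κ σ u) t ≠ 0 := by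
  rcases ht with ⟨hc, hα⟩ | ⟨hc, hα⟩
  · rw [(b.spikePiece_eventuallyEq_lo hκ hκ12 h8 h7 σ u hα).deriv_eq]
    exact b.deriv_spikePtLo_ne_zero hf hκ h8 h8r hgood hu hα hc
  · rw [(b.spikePiece_eventuallyEq_hi hκ hκ12 h8 h7' σ u hα).deriv_eq]
    exact b.deriv_spikePtHi_ne_zero hf hκ h8 h8r hgood hu hα hc

omit hκ in
omit b in
/-- `ψ⁻¹` is injective (as a map to `ℝ⁴`). [folklore] -/
theorem coe_psiN_symm_injective : Injective (fun y : 𝔼 3 ↦ ((psiN.symm y : 𝕊 3) : 𝔼 4)) := by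
  intro y y' h
  have h1 : psiN.symm y = psiN.symm y' := Subtype.ext h
  have := congrArg psiN h1
  rwa [isFullChart_psiN.apply_symm, isFullChart_psiN.apply_symm] at this

include hf hκ12 h8 h8r hgood hε56 in
/-- **The spiked piece function is injective on the spike set** (for `u ∈ [0, 1]`): on each core by
the strict monotonicity of the first blow-up coordinate, across the cores by the sign of the second.
[folklore] -/
theorem injOn_spikePiece {σ u : ℝ} (hu : u ∈ Icc (0 : ℝ) 1) : InjOn (b.spikePiece hcross κ σ u) (b.spikeSet κ) := by
  have hA : κ * (7 + 1) < r := by linarith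
  have hgood' : ε * (1 + bumpBound * (7 + 1)) ≤ 1 / 2 := by norm_num; linarith
  have hsc : ∀ {α : ℝ}, |α| < 7 → κ * (|α| + 1) < r := fun hα ↦ scale_of_abs_lt hκ h8r hα
  have h56 : ∀ {α : ℝ}, |α| < 7 → ε * (|α| + 1) ≤ 5 / 6 := fun hα ↦ by
    have hε := hf.eps_nonneg; nlinarith
  rintro s (⟨hsc', hsα⟩ | ⟨hsc', hsα⟩) t (⟨htc, htα⟩ | ⟨htc, htα⟩) hst
  · rw [b.spikePiece_coreLo hcross hκ hκ12 h8 σ u hsc' (b.abs_alphaLo_lt_of_mem hsα),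
      b.spikePiece_coreLo hcross hκ hκ12 h8 σ u htc (b.abs_alphaLo_lt_of_mem htα)] at hst
    have h1 := coe_psiN_symm_injective hst
    have h2 := b.injOn_pieceLo hf hκ hu σ hA hgood'
      (show b.alphaLo κ s ∈ Icc (-7 : ℝ) 7 from ⟨by linarith [hsα.1], by linarith [hsα.2]⟩)
      (show b.alphaLo κ t ∈ Icc (-7 : ℝ) 7 from ⟨by linarith [htα.1], by linarith [htα.2]⟩) h1
    exact (b.strictMonoOn_alphaLo hκ).injOn hsc' htc h2
  · rw [b.spikePiece_coreLo hcross hκ hκ12 h8 σ u hsc' (b.abs_alphaLo_lt_of_mem hsα),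
      b.spikePiece_coreHi hcross hκ hκ12 h8 σ u htc (b.abs_alphaHi_lt_of_mem htα)] at hst
    have h1 := coe_psiN_symm_injective hst
    exact absurd h1 (b.pieceLo_ne_pieceHi hf hκ hu hu σ (hsc (b.abs_alphaLo_lt_of_mem hsα))
      (hsc (b.abs_alphaHi_lt_of_mem htα)) (h56 (b.abs_alphaLo_lt_of_mem hsα)) (h56 (b.abs_alphaHi_lt_of_mem htα)))
  · rw [b.spikePiece_coreHi hcross hκ hκ12 h8 σ u hsc' (b.abs_alphaHi_lt_of_mem hsα),
      b.spikePiece_coreLo hcross hκ hκ12 h8 σ u htc (b.abs_alphaLo_lt_of_mem htα)] at hst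
    have h1 := coe_psiN_symm_injective hst
    exact absurd h1.symm (b.pieceLo_ne_pieceHi hf hκ hu hu σ (hsc (b.abs_alphaLo_lt_of_mem htα))
      (hsc (b.abs_alphaHi_lt_of_mem hsα)) (h56 (b.abs_alphaLo_lt_of_mem htα)) (h56 (b.abs_alphaHi_lt_of_mem hsα)))
  · rw [b.spikePiece_coreHi hcross hκ hκ12 h8 σ u hsc' (b.abs_alphaHi_lt_of_mem hsα),
      b.spikePiece_coreHi hcross hκ hκ12 h8 σ u htc (b.abs_alphaHi_lt_of_mem htα)] at hst
    have h1 := coe_psiN_symm_injective hst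
    have h2 := b.injOn_pieceHi hf hκ hu σ hA hgood'
      (show b.alphaHi κ s ∈ Icc (-7 : ℝ) 7 from ⟨by linarith [hsα.1], by linarith [hsα.2]⟩)
      (show b.alphaHi κ t ∈ Icc (-7 : ℝ) 7 from ⟨by linarith [htα.1], by linarith [htα.2]⟩) h1
    exact (b.strictAntiOn_alphaHi hκ).injOn hsc' htc h2

end Flat

end BandData

end Literature.Topology.FourManifolds
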